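import Summits.ABC.IUTFork.Repair.CandInternal2RealLabelsLicenceGenuineK
import HarnessLib

/-!
# D-0079 RESCUE sub-cell R-H («local-height condition I06⋆»), ROUND 1 row 6 «shallow-wuc» — the deciding declaration `HStarShallowWuc`
# typed at the GENUINE `K`-level datum `Cor312Prov.pilotDataOfK D K`, its column recipe, its k2 door BY NAME, and the kernel answer to
# «is it anywhere weaker than I06⋆?» (NO: it IMPLIES every real I06⋆ cell on its scope)

abc-iut cell, rung LADDER-ABC:A2.RESCUE.H; seat abc-iut-rh-typ-6 gen 0 (R-H ROUND 1 PAIR n = 6 TYPER; director-abc W13 (A) 15:32:46Z, D-0107);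
row 6 of `plan/rescue/R-H/RH-CANDIDATES.tsv` v1 (sha16 f7773e15cd7f6906, one writer abc-iut-rh-lead g0), harvested from the lens seats
abc-iut-lens-wuc-1 («weakest precondition of the inhabited theorems») and abc-iut-lens-nearmiss-1 and -nearmiss-2 (shallow inhabited side). TAKES NO SIDE
on [IUTchIII] Cor. 3.12 or on any author; nothing here asserts abc proved or refuted; `HStarShallowWuc` is an R-H CANDIDATE — a HYPOTHESIS on
the initial Θ-data, never asserted, never a Literature fact; typed ≠ proved; refuted-as-typed ≠ refuted-in-print.

ROW 6, VERBATIM (informal statement column): «forall bad w: l⋆^2 · m_q(w) < e_w («realises_shallow»: the Theta-pilot at every label stays inside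
the unit lattice level) — plus whatever binder the proof terms of p439445/p439967/p441105 actually consume (typer extracts the exact antecedent
union)»; k1_recipe column: «per row: l⋆^2 · m_q < e_w from columns (m_q = e_w·H/(2l) in HEX units ⇒ holds iff l⋆^2 · H < 2l)».

WHAT THE PROOF TERMS CONSUME (abc-iut-w5-d236 p439445 `Thm311.Real.exists_qPinned_and_hull_settingPrVolSharp_of_realises_shallow`, read binder
by binder in `window_of_realises_shallow`): besides the realising-idele binders of the certificate itself (`ht0 ht htq0 htq1 htq`), EXACTLY two
datum-side hypotheses — `htame : ∀ v ∈ X.S, 2 < p_v ∧ e_v ≤ p_v − 2` (BOTH clauses are used: `hp2`, `hev`) and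
`hdeg : ∀ v ∈ X.S, 1 ≤ P_q(v) ∧ (l⋆)²·P_q(v) < e_v + 1` (both used). So the EXACT antecedent is «every bad place TAME, `1 ≤ P_q ∧ (l⋆)²·P_q < e + 1`»;
at genuine data `1 ≤ P_q` is automatic (abc-iut-w5-d009 `Cor312Prov.one_le_qPilot_pilotDataOfK`) and `P_q(w) = m_q(w) ∈ ℕ`, so the strict real
inequality is the integer one `(l⋆)²·m_q ≤ e_w` — the row's «<» is the theorem's «< e_w + 1». (p439967 = abc-iut-w5-d180's slot-mover frame lemma
and p441105 = abc-iut-w4-d087's `licence_settingPrVolSharp_of_tame` consume MOVER-level / exact-tame-licence-cell antecedents, i.e. row 5's band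
and row 15's slot-reach; the present row is the ONE-FACTOR («last slot») member of that family and is typed as such.)

CONTENTS (namespace `Summit.ABC.IUTFork.Repair.RHShallowWuc`; everything consumed BY NAME, nothing restated):
* §1 `ShallowWucRow p e m L` — the k1 ROW PREDICATE in the integer column vocabulary of I06STAR-COLUMNS (`p`, `e_w`, `m_q = e_w·H/(2l)`, `L = l⋆`):
  `(2 < p ∧ e ≤ p − 2) ∧ (1 ≤ m ∧ L²·m ≤ e)`; **`HStarShallowWuc D`** — THE DECIDING DECLARATION: p439445's `htame ∧ hdeg` at `X := pilotDataOfK D K`, verbatim.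
* §2 `hStar_iff_rows` — `HStarShallowWuc D` ⟺ every bad place's row satisfies `ShallowWucRow` (dictionary `P_q(w) = m ∈ ℕ`,
  `Cor312Prov.exists_nat_qPilot_pilotDataOfK`); `row_iff_scaled` — the recipe in `H`-units (`(l⋆)²·m_q ≤ e_w ⟺ (l⋆)²·(2l·m_q) ≤ 2l·e_w`, i.e.
  `(l⋆)²·H ≤ 2l` after dividing by `e_w > 0`); worked rows by `decide` (S-X75 holds; S-X72, HEX:1:11, DH11a1, DH67a1 fail).
* §3 THE k4 QUESTION IN KERNEL — **`realStar_of_hStar`**: for q-ideles REALISING `P_q`, `HStarShallowWuc D` ⟹ the REAL I06⋆ cell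
  `t_{q,w} ∈ t_{q,w}^{j²}·ℐ_{K_w}` at EVERY bad place `w` and EVERY label `j ∈ 𝔽_l^⋇` (`(j²−1)·m ≤ ((l⋆)²−1)·m ≤ e − 1`, abc-iut-w5-d068's tame cell
  `mem_pow_smul_logShell_qIdele_pilotDataOfK_iff_of_tame`). So H⋆_6 is STRONGER than I06⋆ wherever it holds: NO cell with H⋆_6 true and I06⋆ NEG
  exists — as a RESCUE of I06⋆ it separates nothing (k4), it is the INHABITED CORNER of I06⋆ itself; `row_strict_witness` — the converse fails
  already in integers (`(p, e, m, L) = (11, 7, 2, 2)`: all I06⋆ cells `(L²−1)·m ≤ e − 1` hold, the row predicate fails).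
* §4 k2 BY NAME — `licence_settingPrVolSharp_pilotDataOfK_of_hStar` / **`exists_qPinned_and_hull_settingPrVolSharp_pilotDataOfK_of_hStar`**: p439445 at
  `X := pilotDataOfK D K` — `HStarShallowWuc D` ⟹ the (xi-f) licence and branch C's per-datum S_H antecedent «∃ ρ qK, QPinned ∧ PilotKummerCompatHull»
  at the window bed `settingPrVolSharp (pilotDataOfK D K) …` (realising ideles, any columns).
* §5 SCOPE AT GENUINE DATA BY NAME — `necessary_of_hStar`: abc-iut-w5-d009 `Cor312Prov.genuine_necessary_of_shallow_locus_pilotDataOfK`: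
  `HStarShallowWuc D` forces `l + 2 ≤ p_w`, `(l⋆)²·ord_v(q_v) ≤ 2l·e(v|p) + 1`, `l ≤ 8·e(v|p) + 1`, `l ≤ 8·[F:ℚ] + 1` at every bad place — so on R-W's
  HEX λ_k family (`p = 7`, `l ≥ 11`, `e(v|7) = 1`) the scope is EMPTY by theorem, not only by count.

HONEST SCOPE. OUR sharp containers and Dupuy–Hilado's typed (Ind2) exactly as in the cited files; the licence is a STRONGER-THAN-PRINT form of
Step (xi-f); nothing about the printed GLOBAL inequality; whether any collection of initial Θ-data meets `HStarShallowWuc` is NOT claimed.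
[cite: Mochizuki2012, IUTchI Def. 3.1 (b),(c) pp. 61–62, Ex. 3.2 (iv) p. 71; IUTchIII Cor. 3.12 p. 173–174, Step (xi-f) p. 184; IUTchIV Prop. 1.2 (i) p. 10]
[cite: MochizukiAbsTopIII2015, Def 5.4 (iii) p. 126] [cite: DupuyHilado2025, §3.3, §3.4, §3.9, §4.9] [claim: Mochizuki2012, status: disputed] for
every IUT sentence quoted. Axioms: standard.
-/

noncomputable section

open Set Metric Function NumberField IsDedekindDomain
open scoped Pointwise

namespace Summit.ABC.IUTFork.Repair.RHShallowWuc

open Literature.AnabelianGeometry.AbsoluteAnabelian Literature.IUT.LogThetaLattice Literature.IUT.LogVolume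
  Literature.IUT.HodgeTheaters Literature.NumberTheory.NumberFields
open Summit.ABC.IUTFork.Thm311 Summit.ABC.IUTFork.Thm311.Real Summit.ABC.IUTFork.Cor312 Summit.ABC.IUTFork.Cor312.Setting
  Summit.ABC.IUTFork.Cor312Vol Summit.ABC.IUTFork.Cor312Prov Summit.ABC.IUTFork.Repair.CandInternal2RealLabels
  Summit.ABC.IUTFork.Repair.CandInternal2RealLabelsLicenceGenuineK

/-! ## §1. The row predicate (integer column currency) and the deciding declaration -/

/-- **k1 ROW PREDICATE of row 6 «shallow-wuc»** in the integer column vocabulary of `plan/rescue/R-H/I06STAR-COLUMNS.tsv` (START-HERE v1.2 §2):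
`p` the residue characteristic, `e = e_w`, `m = m_q(w) = e_w·H/(2l) = P_q(w)` (the integral q-pilot degree, W's `P_w`), `L = l⋆ = (l−1)/2`:
«the place is TAME (`2 < p`, `e ≤ p − 2`) and `1 ≤ m`, `L²·m ≤ e`» (plain arithmetic; the k1 recipe of an R-H candidate, not a fact). [folklore] -/
@[folklore]
def ShallowWucRow (p e m L : ℕ) : Prop := (2 < p ∧ e ≤ p - 2) ∧ (1 ≤ m ∧ L ^ 2 * m ≤ e)

variable {F K Fbar : Type} [Field F] [NumberField F] [Field K] [NumberField K] [Algebra F K] [Field Fbar]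
  [Algebra F Fbar] [Algebra K Fbar] {E : WeierstrassCurve F} [E.IsElliptic] {l : ℕ} {Pb : BadPlacePredicates K}

/-- **H⋆_6 = `HStarShallowWuc` — R-H ROUND 1 row 6 «shallow-wuc», THE DECIDING DECLARATION** [R-H candidate, hypothesis — not a fact].
Row 6 verbatim: «forall bad w: l⋆^2 · m_q(w) < e_w («realises_shallow»: the Theta-pilot at every label stays inside the unit lattice level) — plus
whatever binder the proof terms of p439445/p439967/p441105 actually consume». Typed as EXACTLY the two datum-side hypotheses `htame ∧ hdeg` of
abc-iut-w5-d236's `Thm311.Real.exists_qPinned_and_hull_settingPrVolSharp_of_realises_shallow` (p439445) at the genuine `K`-level Dupuy–Hilado datum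
`X := Cor312Prov.pilotDataOfK D K` of a collection of initial Θ-data `D` ([IUTchI] Def. 3.1): at every bad place `w` of `K`, (i) `w` is TAME —
`2 < p_w` and `e_w ≤ p_w − 2` — and (ii) `1 ≤ P_q(w)` and `(l⋆)²·P_q(w) < e_w + 1` (SHALLOW: the Θ-pilot `j²·P_q(w)` stays inside the first lattice
level at every label `j ≤ l⋆`). A condition on WHICH initial Θ-data are admitted (datum-side class); no carrier, label or place cut.
Claim-tagged like every R-H candidate (START-HERE v1.2: hypotheses are claim-tagged Props); the tag records the DISPUTED source setting, not an endorsement.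
[cite: Mochizuki2012, IUTchI Def. 3.1 (b),(c) pp. 61–62, Ex. 3.2 (iv) p. 71] [cite: DupuyHilado2025, §3.3, §3.4] [claim: Mochizuki2012, status: disputed] -/
@[claim "Mochizuki2012" "disputed"]
def HStarShallowWuc (D : InitialThetaData F K Fbar E l Pb) : Prop :=
  (∀ w ∈ (pilotDataOfK D K).S, 2 < residueChar K w ∧ ramIdx K w ≤ residueChar K w - 2) ∧
    ∀ w ∈ (pilotDataOfK D K).S, 1 ≤ (pilotDataOfK D K).qPilot w ∧
      (((pilotDataOfK D K).lstar : ℕ) : ℝ) ^ 2 * (pilotDataOfK D K).qPilot w < (ramIdx K w : ℝ) + 1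

/-! ## §2. Dictionary: H⋆_6 ⟺ every bad place's row satisfies `ShallowWucRow`; the recipe in `H`-units; worked rows -/

/-- The real degree window on an INTEGRAL pilot degree is the integer inequality: `1 ≤ m ∧ L²·m < e + 1 ⟺ 1 ≤ m ∧ L²·m ≤ e`. [folklore] -/
theorem degree_window_iff_nat (L e m : ℕ) :
    ((1 : ℝ) ≤ (m : ℝ) ∧ ((L : ℕ) : ℝ) ^ 2 * (m : ℝ) < (e : ℝ) + 1) ↔ (1 ≤ m ∧ L ^ 2 * m ≤ e) := by
  constructor
  · rintro ⟨h1, h2⟩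
    refine ⟨by exact_mod_cast h1, ?_⟩
    have h3 : ((L ^ 2 * m : ℕ) : ℝ) < ((e + 1 : ℕ) : ℝ) := by push_cast; exact h2
    have h4 : L ^ 2 * m < e + 1 := by exact_mod_cast h3
    omega
  · rintro ⟨h1, h2⟩
    refine ⟨by exact_mod_cast h1, ?_⟩
    have h4 : L ^ 2 * m < e + 1 := by omega
    have h3 : ((L ^ 2 * m : ℕ) : ℝ) < ((e + 1 : ℕ) : ℝ) := by exact_mod_cast h4
    push_cast at h3
    exact h3

variable (D : InitialThetaData F K Fbar E l Pb)

/-- **H⋆_6 ⟺ THE ROW PREDICATE AT EVERY BAD PLACE** (the k1 dictionary): with `P_q(w) = m ∈ ℕ` ([IUTchI] Ex. 3.2 (iv), abc-iut-w5-d009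
`Cor312Prov.exists_nat_qPilot_pilotDataOfK`), `HStarShallowWuc D` says exactly that every bad place `w` has an integral pilot degree `m` with
`ShallowWucRow p_w e_w m l⋆`. [cite: Mochizuki2012, IUTchI Ex. 3.2 (iv) p. 71] [cite: DupuyHilado2025, §3.3] -/
theorem hStar_iff_rows :
    HStarShallowWuc D ↔ ∀ w ∈ (pilotDataOfK D K).S, ∃ m : ℕ, (pilotDataOfK D K).qPilot w = m ∧
      ShallowWucRow (residueChar K w) (ramIdx K w) m (pilotDataOfK D K).lstar := by
  constructor
  · rintro ⟨htame, hdeg⟩ w hw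
    obtain ⟨m, hm, _, _⟩ := exists_nat_qPilot_pilotDataOfK D hw
    refine ⟨m, hm, htame w hw, ?_⟩
    have h := hdeg w hw
    rw [hm] at h
    exact (degree_window_iff_nat _ _ _).1 h
  · intro h
    refine ⟨fun w hw => ?_, fun w hw => ?_⟩
    · obtain ⟨m, _, hrow, _⟩ := h w hw
      exact hrow
    · obtain ⟨m, hm, _, hrow⟩ := h w hw
      rw [hm]
      exact (degree_window_iff_nat _ _ _).2 hrow

/-- **The recipe in `H`-units** (I06STAR-COLUMNS carries `H = ord_p(q_E) = 2l·m_q/e_w`, not `m_q`): for `c > 0` (intended `c = 2l`),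
`L²·m ≤ e ⟺ L²·(c·m) ≤ c·e`; dividing by `e_w > 0` this is the row's «`l⋆²·H ≤ 2l`» (the row text's strict `<` is the theorem's `< e_w + 1`,
i.e. `≤` on integers). [folklore] -/
theorem row_iff_scaled {c : ℕ} (hc : 0 < c) (L e m : ℕ) : L ^ 2 * m ≤ e ↔ L ^ 2 * (c * m) ≤ c * e := by
  constructor
  · intro h
    calc L ^ 2 * (c * m) = c * (L ^ 2 * m) := by ring
      _ ≤ c * e := Nat.mul_le_mul_left c h
  · intro h
    have h' : c * (L ^ 2 * m) ≤ c * e := by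
      calc c * (L ^ 2 * m) = L ^ 2 * (c * m) := by ring
        _ ≤ c * e := h
    exact Nat.le_of_mul_le_mul_left h' hc

/-- Worked row S-X75 / S-X75i of I06STAR-COLUMNS (`p = 7`, `e_w = 5`, `H = 2`, `l = 5`: `m_q = 5·2/10 = 1`, `l⋆ = 2`): the row predicate HOLDS
(`5 ≤ 5`, `4·1 ≤ 5`) — consistent with the table's `i06star_datum = POS` there. [folklore] -/
theorem row_x75 : ShallowWucRow 7 5 1 2 := by unfold ShallowWucRow; decide

/-- Worked row S-X72 (`p = 7`, `e_w = 2`, `H = 5`, `l = 5`: `m_q = 1`, `l⋆ = 2`): FAILS (`4 > 2`) — the table has `NEG` at `j = 2`. [folklore] -/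
theorem row_x72 : ¬ ShallowWucRow 7 2 1 2 := by unfold ShallowWucRow; decide

/-- Worked row HEX λ_1, `l = 11`, local type `e(v|7) = 1` (`p = 7`, `e_w = 11`, `H = 2`: `m_q = 1`, `l⋆ = 5`): FAILS — not tame (`11 > 5`) and not
shallow (`25 > 11`). Every HEX row has `p = 7 ≤ e_w`, so the tame clause fails on the whole family. [folklore] -/
theorem row_hex_1_11 : ¬ ShallowWucRow 7 11 1 5 := by unfold ShallowWucRow; decide

/-- Worked row `concrete:DH11a1` (Dupuy–Hilado I §2.10: `p = 11`, `e_w = 78`, `H = 5`, `l = 13`: `m_q = 78·5/26 = 15`, `l⋆ = 6`): FAILS (deep: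
`78 > 9`; and `36·15 > 78`). [folklore] -/
theorem row_dh11a1 : ¬ ShallowWucRow 11 78 15 6 := by unfold ShallowWucRow; decide

/-- Worked row `concrete:DH67a1` (`p = 67`, `e_w = 210`, `H = 1`, `l = 7`: `m_q = 210/14 = 15`, `l⋆ = 3`): FAILS although the table has EVERY
I06⋆ cell POS there (deep place, `210 > 65`; the shallow clause `9·15 = 135 ≤ 210` alone would hold) — a table row where I06⋆ holds and H⋆_6
does not. [folklore] -/
theorem row_dh67a1 : ¬ ShallowWucRow 67 210 15 3 := by unfold ShallowWucRow; decide

/-! ## §3. The k4 question in kernel: H⋆_6 IMPLIES every real I06⋆ cell on its scope (so it is nowhere weaker than I06⋆) -/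

/-- Integer core: `1 ≤ m`, `L²·m ≤ e`, `1 ≤ j ≤ L` ⟹ `(j² − 1)·m ≤ e − 1` (`(j²−1)·m ≤ (L²−1)·m = L²m − m ≤ e − 1`). [folklore] -/
theorem jsq_sub_one_mul_le_of_row {e m L j : ℕ} (hm : 1 ≤ m) (hsh : L ^ 2 * m ≤ e) (hjL : j ≤ L) :
    ((j : ℤ) ^ 2 - 1) * (m : ℤ) ≤ (e : ℤ) - 1 := by
  have h1 : (j : ℤ) ^ 2 ≤ (L : ℤ) ^ 2 := by
    have : (j : ℤ) ≤ (L : ℤ) := by exact_mod_cast hjL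
    have hj0 : (0 : ℤ) ≤ (j : ℤ) := by positivity
    nlinarith
  have h2 : ((L : ℤ) ^ 2) * (m : ℤ) ≤ (e : ℤ) := by exact_mod_cast hsh
  have hm' : (1 : ℤ) ≤ (m : ℤ) := by exact_mod_cast hm
  have hm0 : (0 : ℤ) ≤ (m : ℤ) := by positivity
  nlinarith

/-- **STRICTNESS WITNESS (integers)**: at `(p, e, m, L) = (11, 7, 2, 2)` (a tame local class, `e = 7 ≤ 9`) every I06⋆ cell in the tame closed form
`(j²−1)·m ≤ e − 1`, `j ≤ L`, HOLDS (`3·2 = 6 ≤ 6`), while `ShallowWucRow` FAILS (`4·2 = 8 > 7`): I06⋆ does NOT imply H⋆_6 — H⋆_6 is STRICTLY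
stronger. (Synthetic local class; whether a genuine datum realises it is not claimed.) [folklore] -/
theorem row_strict_witness :
    (∀ j : ℕ, 1 ≤ j → j ≤ 2 → ((j : ℤ) ^ 2 - 1) * (2 : ℤ) ≤ (7 : ℤ) - 1) ∧ ¬ ShallowWucRow 11 7 2 2 := by
  refine ⟨fun j hj1 hj2 => ?_, by unfold ShallowWucRow; decide⟩
  interval_cases j <;> norm_num

variable (tq : ∀ (pp : Nat.Primes) (x : (thetaIndex (pilotDataOfK D K)).Fibre (.inr pp)),
    haveI : Fact (pp : ℕ).Prime := ⟨pp.2⟩; kOf (pilotDataOfK D K) pp.1 x)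
  (htq0 : ∀ pp x, tq pp x ≠ 0)
  (htq : ∀ (pp : Nat.Primes) (x : (thetaIndex (pilotDataOfK D K)).Fibre (.inr pp)),
    haveI : Fact (pp : ℕ).Prime := ⟨pp.2⟩
    Real.log ‖tq pp x‖ = -((pilotDataOfK D K).qPilot (placeOf (pilotDataOfK D K) pp.1 x)) *
      logNorm K (placeOf (pilotDataOfK D K) pp.1 x) / localDegree K (placeOf (pilotDataOfK D K) pp.1 x))

include htq0 htq in
/-- **H⋆_6 ⟹ EVERY REAL I06⋆ CELL** (the k4 question of row 6, «does shallow ⇒ I06⋆?» — YES). For a q-idele family `t_q` REALISING `P_q`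
(`‖t_{q,w}‖ = p^{−P_q(w)/e_w}`, the certificate's `htq0`/`htq` binders): if `HStarShallowWuc D`, then at EVERY bad place `w | p` of the genuine datum
and EVERY label `j = i+1 ∈ 𝔽_l^⋇`, `t_{q,w} ∈ t_{q,w}^{j²}·ℐ_{K_w}` — abc-iut-rp-d2's real I06⋆ cell (`ℐ_{K_w} = (p*)⁻¹·log_p(𝒪^×_{K_w})`, [AbsTopIII]
Def. 5.4 (iii)) is DECIDED-POS. Route: the place is tame, so abc-iut-w5-d068's `mem_pow_smul_logShell_qIdele_pilotDataOfK_iff_of_tame` reads the cell as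
`(j²−1)·m ≤ e_w − 1`, which follows from `L²·m ≤ e_w`, `m ≥ 1`, `j ≤ L` (`jsq_sub_one_mul_le_of_row`). CONSEQUENCE FOR k4: there is NO cell at which
H⋆_6 holds and the I06⋆ cell fails — as a rescue of I06⋆ the candidate separates nothing; it is the inhabited corner INSIDE I06⋆.
[cite: MochizukiAbsTopIII2015, Def 5.4 (iii) p. 126] [cite: DupuyHilado2025, §3.4] [claim: Mochizuki2012, status: disputed] -/
theorem realStar_of_hStar (h : HStarShallowWuc D) (pp : Nat.Primes) (i : Fin (pilotDataOfK D K).lstar)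
    (w : (thetaIndex (pilotDataOfK D K)).Fibre (.inr pp))
    (hw : haveI : Fact (pp : ℕ).Prime := ⟨pp.2⟩; placeOf (pilotDataOfK D K) pp.1 w ∈ (pilotDataOfK D K).S) :
    haveI : Fact (pp : ℕ).Prime := ⟨pp.2⟩
    tq pp w ∈ tq pp w ^ (((i : ℕ) + 1) ^ 2) • logShell (PadicLogOnUnits.ofUnitLog (pp : ℕ) (kOf (pilotDataOfK D K) pp.1 w)) := by
  haveI hF : Fact (pp : ℕ).Prime := ⟨pp.2⟩
  obtain ⟨m, hm, hrow⟩ := (hStar_iff_rows D).1 h _ hw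
  obtain ⟨⟨hp2, hep⟩, hm1, hsh⟩ := hrow
  have hres : residueChar K (placeOf (pilotDataOfK D K) pp.1 w) = (pp : ℕ) :=
    residueChar_eq_of_natCast_mem (pp : ℕ) (natCast_mem_placeOf (pilotDataOfK D K) pp.1 w)
  rw [hres] at hp2 hep
  have hram : (placeOf (pilotDataOfK D K) pp.1 w).asIdeal.ramificationIdx ℤ = ramIdx K (placeOf (pilotDataOfK D K) pp.1 w) :=
    (ramIdx_eq K (placeOf (pilotDataOfK D K) pp.1 w)).symm
  refine (mem_pow_smul_logShell_qIdele_pilotDataOfK_iff_of_tame D tq htq0 htq pp w hp2 hep hram hm (((i : ℕ) + 1) ^ 2)).2 ?_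
  have hjL : (i : ℕ) + 1 ≤ (pilotDataOfK D K).lstar := by have := i.2; omega
  have := jsq_sub_one_mul_le_of_row hm1 hsh hjL
  push_cast at this ⊢
  linarith

/-! ## §4. The k2 door BY NAME: p439445 at `X := pilotDataOfK D K` -/

section Door

variable {logv : PadicLogs K} (hlog : LogvAnalytic logv)
  (M : Type) [Field M] [NumberField M]
  (archPk : ∀ (j : (thetaIndex (pilotDataOfK D K)).Label) (vQ : (thetaIndex (pilotDataOfK D K)).VQ),
    Set ((logShellsDH (pilotDataOfK D K) logv).Packet j vQ))
  (archSub : ∀ (j : (thetaIndex (pilotDataOfK D K)).Label) (v : (thetaIndex (pilotDataOfK D K)).V),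
    Set ((logShellsDH (pilotDataOfK D K) logv).Packet j ((thetaIndex (pilotDataOfK D K)).over v)))
  (Ψ : ℤ → ∀ v : (thetaIndex (pilotDataOfK D K)).V, v ∈ (thetaIndex (pilotDataOfK D K)).Vbad →
    Set ((logShellsDH (pilotDataOfK D K) logv).StarPacket v))
  (act : ℤ → ∀ v : (thetaIndex (pilotDataOfK D K)).V, v ∈ (thetaIndex (pilotDataOfK D K)).Vbad →
    (logShellsDH (pilotDataOfK D K) logv).StarPacket v → Module.End ℚ ((logShellsDH (pilotDataOfK D K) logv).StarPacket v))
  (Mmod : ℤ → ∀ j : (thetaIndex (pilotDataOfK D K)).LabelStar, Set ((logShellsDH (pilotDataOfK D K) logv).GlobalPacket j.1))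
  (region : ℤ → ∀ j : (thetaIndex (pilotDataOfK D K)).LabelStar, FinDivisor M → ∀ vQ : (thetaIndex (pilotDataOfK D K)).VQ,
    Set ((logShellsDH (pilotDataOfK D K) logv).Packet j.1 vQ))
  (n : ℤ) {HT : Type} {LogLink : HT → HT → Type} {IsFull : ∀ {s t : HT}, LogLink s t → Prop}
  (lat : LGPGaussianLogThetaLattice LogLink IsFull)
  {Frd : Type} {IsoF : Frd → Frd → Type} {Ob : Frd → Type} {realify : Frd → Frd} {Strip : Type}
  {IsoS : Strip → Strip → Type} {Mv : ∀ v : (thetaIndex (pilotDataOfK D K)).V, v ∈ (thetaIndex (pilotDataOfK D K)).Vbad → Type}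
  [∀ v h, Monoid (Mv v h)]
  (sig : GlobalLGPFrobenioidSignature (thetaIndex (pilotDataOfK D K)).lstar (thetaIndex (pilotDataOfK D K)).V
    (· ∈ (thetaIndex (pilotDataOfK D K)).Vbad) Frd IsoF Ob realify Strip IsoS Mv)
  (split : SplittingMonoids Mv) {ObΔ : Type} {N : ∀ v : (thetaIndex (pilotDataOfK D K)).V, v ∈ (thetaIndex (pilotDataOfK D K)).Vbad → Type}
  [∀ v h, Monoid (N v h)] (qData : QPilotData ObΔ N)
  (t : ∀ (pp : Nat.Primes) (_ : Fin (pilotDataOfK D K).lstar) (x : (thetaIndex (pilotDataOfK D K)).Fibre (.inr pp)),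
    haveI : Fact (pp : ℕ).Prime := ⟨pp.2⟩; kOf (pilotDataOfK D K) pp.1 x)
  (htq1 : ∀ (pp : Nat.Primes) (x : (thetaIndex (pilotDataOfK D K)).Fibre (.inr pp)),
    haveI : Fact (pp : ℕ).Prime := ⟨pp.2⟩; placeOf (pilotDataOfK D K) pp.1 x ∉ (pilotDataOfK D K).S → ‖tq pp x‖ = 1)
  (col : ℤ → Column (logShellsDH (pilotDataOfK D K) logv))
  (ht0 : ∀ pp i x, t pp i x ≠ 0)
  (ht : ∀ (pp : Nat.Primes) (i : Fin (pilotDataOfK D K).lstar) (x : (thetaIndex (pilotDataOfK D K)).Fibre (.inr pp)),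
    haveI : Fact (pp : ℕ).Prime := ⟨pp.2⟩
    Real.log ‖t pp i x‖ = -((pilotDataOfK D K).thetaPilot i (placeOf (pilotDataOfK D K) pp.1 x)) *
      logNorm K (placeOf (pilotDataOfK D K) pp.1 x) / localDegree K (placeOf (pilotDataOfK D K) pp.1 x))

include ht0 ht htq in
/-- **k2 DOOR, LICENCE FORM (landed, BY NAME)**: abc-iut-w5-d236's `Thm311.Real.licence_settingPrVolSharp_of_realises_shallow` (p439445) at
`X := pilotDataOfK D K` — for Θ- and q-ideles REALISING the genuine pilot divisors, `HStarShallowWuc D` ⟹ abc-iut-c312-1's (xi-f)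
`Thm311ToCor312.Licence` at abc-iut-c312-7's `settingPrVolSharp (pilotDataOfK D K) …`. [cite: Mochizuki2012, IUTchIII Step (xi) (xi-f) p. 184]
[cite: DupuyHilado2025, §3.4, §3.9, §4.9] [claim: Mochizuki2012, status: disputed] -/
theorem licence_settingPrVolSharp_pilotDataOfK_of_hStar (h : HStarShallowWuc D) :
    Thm311ToCor312.Licence
      (settingPrVolSharp (pilotDataOfK D K) hlog M archPk archSub Ψ act Mmod region n lat sig split qData tq t htq0 htq1) :=
  licence_settingPrVolSharp_of_realises_shallow (pilotDataOfK D K) hlog M archPk archSub Ψ act Mmod region n lat sig split qData tq t htq0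
    htq1 ht0 ht htq h.1 h.2

include ht0 ht htq in
/-- **k2 DOOR, S_H FORM (landed, BY NAME)**: p439445's `exists_qPinned_and_hull_settingPrVolSharp_of_realises_shallow` at `X := pilotDataOfK D K` —
`HStarShallowWuc D` ⟹ branch C's PER-DATUM S_H antecedent «∃ ρ qK, QPinned ∧ PilotKummerCompatHull» at the WINDOW BED
`settingPrVolSharp (pilotDataOfK D K) …` (any columns `col`; realising ideles) — the shape of the binder `hSHw` of abc-iut-C-cert's window certificates
`Conditional.abc_of_SH_v8K_window` / `…_v10K_window` read per datum. H⋆_6 thus passes (k2) by a LANDED theorem; its table rate (k1) is where it dies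
on R-W's HEX family (§5). [cite: Mochizuki2012, IUTchIII Cor. 3.12 p. 173–174, Step (xi-f) p. 184] [cite: DupuyHilado2025, §3.4, §3.9, §4.9]
[claim: Mochizuki2012, status: disputed] -/
theorem exists_qPinned_and_hull_settingPrVolSharp_pilotDataOfK_of_hStar (h : HStarShallowWuc D) :
    ∃ (ρ : (∀ v : (thetaIndex (pilotDataOfK D K)).V, v ∈ (thetaIndex (pilotDataOfK D K)).Vbad →
            Set ((logShellsDH (pilotDataOfK D K) logv).StarPacket v)) →
          ∀ (j : (thetaIndex (pilotDataOfK D K)).Label) (vQ : (thetaIndex (pilotDataOfK D K)).VQ),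
            Set ((logShellsDH (pilotDataOfK D K) logv).Packet j vQ))
        (qK : ∀ v : (thetaIndex (pilotDataOfK D K)).V, v ∈ (thetaIndex (pilotDataOfK D K)).Vbad →
          Set ((logShellsDH (pilotDataOfK D K) logv).StarPacket v)),
        QPinned ({ toSituation := situationPrVol (pilotDataOfK D K) hlog M archPk archSub Ψ act Mmod region, col := col } :
            LatticeSituation (thetaIndex (pilotDataOfK D K)))
          (settingPrVolSharp (pilotDataOfK D K) hlog M archPk archSub Ψ act Mmod region n lat sig split qData tq t htq0 htq1) ρ qK ∧
        PilotKummerCompatHull ({ toSituation := situationPrVol (pilotDataOfK D K) hlog M archPk archSub Ψ act Mmod region, col := col } :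
            LatticeSituation (thetaIndex (pilotDataOfK D K)))
          (settingPrVolSharp (pilotDataOfK D K) hlog M archPk archSub Ψ act Mmod region n lat sig split qData tq t htq0 htq1) ρ qK :=
  exists_qPinned_and_hull_settingPrVolSharp_of_realises_shallow (pilotDataOfK D K) hlog M archPk archSub Ψ act Mmod region n lat sig split
    qData tq t htq0 htq1 col ht0 ht htq h.1 h.2

end Door

/-! ## §5. Scope at genuine data BY NAME: tame forces `p_w ≥ l + 2`, shallow forces `l ≤ 8·e(v|p) + 1` -/

/-- **NECESSARY CONDITIONS OF H⋆_6 AT GENUINE DATA** (abc-iut-w5-d009 `Cor312Prov.genuine_necessary_of_shallow_locus_pilotDataOfK`, verbatim): at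
every bad place `w` (over `v` of `F`, prime `p`): `l + 2 ≤ p_w` (tame ∧ `e_w ≥ l`), `(l⋆)²·ord_v(q_v) ≤ 2l·e(v|p) + 1`, `l ≤ 8·e(v|p) + 1` and
`l ≤ 8·[F : ℚ] + 1`. READING for k1 (numbers in the seat's report, not here): on R-W's HEX λ_k family (`p = 7`, `e(v|7) = 1`, `l ≥ 11`) both
`l + 2 ≤ 7` and `l ≤ 9` fail — the scope of H⋆_6 there is EMPTY by theorem. [cite: Mochizuki2012, IUTchI Def. 3.1 (b),(c) pp. 61–62; Ex. 3.2 (iv) p. 71]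
[cite: DupuyHilado2025, §3.3, §3.4] [claim: Mochizuki2012, status: disputed] -/
theorem necessary_of_hStar (h : HStarShallowWuc D) (w : HeightOneSpectrum (𝓞 K)) (hS : w ∈ (pilotDataOfK D K).S) :
    l + 2 ≤ residueChar K w ∧
      (pilotDataOfK D K).lstar ^ 2 * qParamOrd E (finBelow F K w) ≤ 2 * l * ramIdx F (finBelow F K w) + 1 ∧
      l ≤ 8 * ramIdx F (finBelow F K w) + 1 ∧ l ≤ 8 * Module.finrank ℚ F + 1 :=
  genuine_necessary_of_shallow_locus_pilotDataOfK D h.1 h.2 w hS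

/-- **In particular H⋆_6 is EMPTY at every genuine datum with `l ≥ 8·[F : ℚ] + 2`** (so for each base field `F` only finitely many `l` can meet it;
e.g. HEX: `F = ℚ(λ)`-type rows with `l ≥ 11 > 9`). [cite: Mochizuki2012, IUTchI Def. 3.1 (c) p. 62] [claim: Mochizuki2012, status: disputed] -/
theorem not_hStar_of_large_l (hl : 8 * Module.finrank ℚ F + 2 ≤ l) : ¬ HStarShallowWuc D := by
  intro h
  obtain ⟨w, hw⟩ := (pilotDataOfK D K).S_nonempty
  have := (necessary_of_hStar D h w hw).2.2.2
  omega

/-! ## §6. (k2 of the pair protocol) H⋆_6 against the landed NEGATIVE families, BY SHAPE: it excludes every unramified bad place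
## and every bad place of residue characteristic `≤ l + 1` — it never meets the unramified-odd refutation family or R-W's HEX `p = 7` rows -/

/-- **H⋆_6 EXCLUDES EVERY UNRAMIFIED BAD PLACE** (the unramified-odd NEGATIVE family of record, abc-iut-rp-d2
`CandInternal2Real.not_mem_jsq_smul_logShell_of_unramified` / abc-iut-rp-cx `EvalHonestCeiling.i06_false_of_honest`, lives at `e_w = 1`): if some bad place
`w` of the genuine datum has `e_w = 1` then `HStarShallowWuc D` FAILS — its shallow clause would give `(l⋆)²·P_q(w) < 2` with `l⋆ ≥ 2`, `P_q(w) ≥ 1`.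
So H⋆_6 and the refutation family have DISJOINT supports (no collision is possible); consistent with `realStar_of_hStar` (H⋆_6 ⟹ the I06⋆ cell, which
is NEG there). [cite: Mochizuki2012, IUTchI Def. 3.1 (b),(c) pp. 61–62] [claim: Mochizuki2012, status: disputed] -/
theorem not_hStar_of_ramIdx_eq_one {w : HeightOneSpectrum (𝓞 K)} (hS : w ∈ (pilotDataOfK D K).S) (he : ramIdx K w = 1) :
    ¬ HStarShallowWuc D := by
  intro h
  obtain ⟨m, hm, _, _, hsh⟩ := (hStar_iff_rows D).1 h w hS
  rw [he] at hsh
  have hL : 2 ≤ (pilotDataOfK D K).lstar := (pilotDataOfK D K).two_le_lstar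
  have h4 : 4 * m ≤ (pilotDataOfK D K).lstar ^ 2 * m := Nat.mul_le_mul_right m (by nlinarith)
  omega

/-- **H⋆_6 EXCLUDES EVERY BAD PLACE OF RESIDUE CHARACTERISTIC `≤ l + 1`** (tame needs `e_w ≤ p_w − 2` while `e_w ≥ l` at genuine data,
`necessary_of_hStar`): in particular at every row of R-W's HEX λ_k family (`p = 7`, `l ≥ 11`) and at `concrete:DH11a1` (`p = 11`, `l = 13`).
[cite: Mochizuki2012, IUTchI Def. 3.1 (b),(c) pp. 61–62; Ex. 3.2 (iv) p. 71] [claim: Mochizuki2012, status: disputed] -/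
theorem not_hStar_of_residueChar_le {w : HeightOneSpectrum (𝓞 K)} (hS : w ∈ (pilotDataOfK D K).S) (hp : residueChar K w ≤ l + 1) :
    ¬ HStarShallowWuc D := fun h => by
  have := (necessary_of_hStar D h w hS).1
  omega

/-- **HEX form**: a bad place over `7` (R-W's λ_k K-line family, abc-iut-c312-7 `GenuineK.exists_place_lamSeven`) kills H⋆_6 as soon as `l ≥ 6` — every
admissible `l` of that family (`l ≥ 11`). The k1 number «0/256 on lamSeven» is thus a theorem of the shape, not only a count. [claim: Mochizuki2012, status: disputed] -/
theorem not_hStar_of_residueChar_seven {w : HeightOneSpectrum (𝓞 K)} (hS : w ∈ (pilotDataOfK D K).S) (hp : residueChar K w = 7) (hl : 6 ≤ l) :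
    ¬ HStarShallowWuc D :=
  not_hStar_of_residueChar_le D hS (by omega)

/-! ## §7. Census line U1 in kernel: the TAME-FREE shallow class never crosses the UPPER edge `b_e + c` of the label window
## (so it can never meet a DECIDED-NEG I06⋆ cell either — it lives inside POS ∪ OPEN-shape; source: abc-iut-rp-h1 desk note 17:04:14Z (ii)) -/

/-- **`b_e ≥ −1/e`** for the [IUTchIV] Prop. 1.2 constant `b = ⌊log(p·e/(p−1))/log p⌋ − 1/e` (`p·e/(p−1) ≥ 1`, so the floor is `≥ 0`); sharper
than abc-iut-w5-d054's `neg_one_le_logRadiusB`. [cite: Mochizuki2012, IUTchIV Prop. 1.2 p. 10] -/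
theorem neg_one_div_le_logRadiusB {p e : ℕ} (hp : 2 ≤ p) (he : 1 ≤ e) : -(1 / (e : ℝ)) ≤ logRadiusB p e := by
  unfold logRadiusB
  have hpR : (2 : ℝ) ≤ p := by exact_mod_cast hp
  have heR : (1 : ℝ) ≤ e := by exact_mod_cast he
  have hp1 : (0 : ℝ) < (p : ℝ) - 1 := by linarith
  have hlogp : 0 < Real.log p := Real.log_pos (by linarith)
  have hq : (1 : ℝ) ≤ (p : ℝ) * e / ((p : ℝ) - 1) := by
    rw [le_div_iff₀ hp1]
    nlinarith
  have hfloor : (0 : ℝ) ≤ (⌊Real.log ((p : ℝ) * e / ((p : ℝ) - 1)) / Real.log p⌋ : ℝ) := by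
    have h0 : (0 : ℤ) ≤ ⌊Real.log ((p : ℝ) * e / ((p : ℝ) - 1)) / Real.log p⌋ :=
      Int.floor_nonneg.mpr (div_nonneg (Real.log_nonneg hq) hlogp.le)
    exact_mod_cast h0
  linarith

/-- **THE TAME-FREE SHALLOW CLASS NEVER CROSSES THE UPPER EDGE** (repair-census line U1 of HOME/abc-iut-rh-typ-6/HANDOFF.md, in kernel): for ANY
prime power situation (`p ≥ 2`, `e ≥ 1`, no tameness), `1 ≤ m`, `L²·m ≤ e` and a label `j ≤ L` give `(j² − 1)·m/e ≤ 1 − 1/e ≤ b_e + c`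
(`c = ord_p(p*) ≥ 1`), i.e. in the table's units `h(w, j) = (j²−1)·H/(2l) ≤ κ⁺(w)` at EVERY label: the NECESSARY-side door
(abc-iut-rp-d2 `CandInternal2RealStrata.not_mem_pow_smul_logShell_of_root_lt`, which needs `h > κ⁺`) can never fire on a shallow datum, tame or not.
So dropping the tame clause of H⋆_6 yields a class inside POS ∪ OPEN-shape of I06STAR-COLUMNS — it may re-label OPEN cells at deep places (U-SHAPE decides),
but it can never hold where an I06⋆ cell is DECIDED-NEG: no member of the shallow family is a rescue of a NEG cell. [cite: Mochizuki2012, IUTchIV Prop. 1.2 p. 10]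
[claim: Mochizuki2012, status: disputed] -/
theorem shallow_height_le_upper_edge {p e m L j : ℕ} (hp : 2 ≤ p) (he : 1 ≤ e) (hm : 1 ≤ m) (hsh : L ^ 2 * m ≤ e) (hjL : j ≤ L) :
    (((j : ℝ) ^ 2 - 1) * (m : ℝ)) / (e : ℝ) ≤ logRadiusB p e + ((if p = 2 then 2 else 1 : ℕ) : ℝ) := by
  have heR : (0 : ℝ) < e := by exact_mod_cast he
  have hint : ((j : ℤ) ^ 2 - 1) * (m : ℤ) ≤ (e : ℤ) - 1 := jsq_sub_one_mul_le_of_row hm hsh hjL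
  have hreal : ((j : ℝ) ^ 2 - 1) * (m : ℝ) ≤ (e : ℝ) - 1 := by exact_mod_cast hint
  have h1 : (((j : ℝ) ^ 2 - 1) * (m : ℝ)) / (e : ℝ) ≤ 1 - 1 / (e : ℝ) := by
    have h1' : (1 : ℝ) - 1 / (e : ℝ) = ((e : ℝ) - 1) / (e : ℝ) := by
      field_simp
    rw [h1', div_le_div_iff_of_pos_right heR]
    exact hreal
  have hb := neg_one_div_le_logRadiusB hp he
  have hc : (1 : ℝ) ≤ ((if p = 2 then 2 else 1 : ℕ) : ℝ) := by
    split_ifs <;> norm_num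
  linarith

end Summit.ABC.IUTFork.Repair.RHShallowWuc

end
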